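import Literature.NumberTheory.LFunctions.Zhang2022.Section5Lemma58
import Literature.NumberTheory.LFunctions.Zhang2022.RepairBedScale
import HarnessLib

/-!
# Zhang (2022), rescue GAP/BED (D-0124 (3)(4)): the Lemma 5.8 passage consumes Assumption (A) at strength
# EXACTLY `𝓛⁻¹⁵` — kernel twin of the «minimum premise» datum (GAP G-31 «E ≥ 15 (main terms, Lemma 5.8)»;
# bed-2 NODE2-STEP-LEDGER §6)

Topic `Literature/NumberTheory/LFunctions/Zhang2022` (Landau–Siegel audit tree; verdict-neutral).
Y. Zhang, *Discrete mean estimates and the Landau–Siegel zero*, arXiv:2211.02515v1 (2022)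
[Zhang2022LandauSiegel] — **an unrefereed manuscript under adjudication; nothing in this file asserts or
denies its Theorems 1–2, and nothing here is a claim about Landau–Siegel zeros. The programme SEARCHES and
TYPES; no claim about Landau–Siegel zeros, Theorems 1–2 of arXiv:2211.02515 or a repaired Margin232 until a
kernel theorem says so.**

Lemma 5.8 (§5 p. 11: «if `α ≤ |s−1| ≤ 10α` then `L(s,χ) = L′(1,χ)(s−1) + O(α₂)`, `α₂ = 𝓛⁻¹⁵`; proof: Taylor at
`s = 1`, (A), and a simple bound for `L″`») is the ONLY door through which (A) enters the MAIN TERMS of §§8–10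
(the nodes (8.23)/(9.7)/(10.17) of the rescue bed's node group 2, via Lemmas 8.2/8.4). The tree proves it
(`Lemma58.lemma_5_8_of_le`, `Lemma58.lemma_5_8`) from the printed premise `‖L(1,χ)‖ ≤ 𝓛⁻²⁰²²`, using of it only
`‖L(1,χ)‖ ≤ 𝓛⁻¹⁵` (the line `hA'` of that proof). The rescue's quantification table (GAP G-31, «(A)-exponent E:
main terms only E ≥ 15 — every Lemma-5.8 passage consumes |L(1,χ)| ≤ 𝓛⁻¹⁵») and bed-2's NODE2-STEP-LEDGER §6 record this
as prose. Here it is a pair of kernel facts — SUFFICIENCY and NECESSITY of the exponent 15 at this passage: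

* `lemma58_of_norm_le_pow15` — Lemma 5.8's conclusion on `‖s−1‖ ≤ Kπ𝓛⁻⁹` (`Kπ ≤ 𝓛⁸`) from the WEAKER premise
  `‖L(1,χ)‖ ≤ 𝓛⁻¹⁵` (same constant `1 + 16e^{9/2}π²K²`); `lemma58_printed_of_norm_le_pow15` — the printed range `K = 10`;
* `lemma58_of_assumptionAWith` — hence from `Repair.Bed.AssumptionAWith E D χ` (`‖L(1,χ)‖ < 𝓛^{−E}`) for EVERY real
  exponent `E ≥ 15` (the printed (A) is `E = 2022`, `Repair.Bed.assumptionA_iff_with`);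
* `norm_LFunction_one_le_of_lemma58` — conversely, Lemma 5.8's conclusion on any range containing `s = 1` FORCES
  `‖L(1,χ)‖ ≤ C·𝓛⁻¹⁵` (take `s = 1`): the passage cannot be fed by any premise weaker than `O(𝓛⁻¹⁵)`.

So «E ≥ 15» is, for this passage, not an estimate but an equivalence of shape: the Lemma 5.8 step CLOSES under
`‖L(1,χ)‖ ≤ 𝓛⁻¹⁵` and under nothing weaker. Where the manuscript consumes the remaining `𝓛⁻²⁰⁰⁷` of (A) (Prop. 2.2's
exceptional-set route, GAP G-31 «E ≥ 2000 (S0)», `Repair.Gap.ExpTuple.budgetS0_2000`) is not this file's subject.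
Theorems only; no definition, no named fact; nothing about (A) itself.

## References

* Y. Zhang, arXiv:2211.02515v1 (2022), §5 Lemma 5.8 (p. 11); §2 (2.1), (2.6), (2.10), Assumption (A) p. 4.
  [cite: Zhang2022LandauSiegel, §5, Lemma 5.8]
-/

noncomputable section

open Complex Real

namespace Literature.NumberTheory.LFunctions.Zhang2022.Repair.Gap

open Literature.NumberTheory.LFunctions.Zhang2022.Lemma58 (norm_taylor_two_remainder_le)
open Literature.NumberTheory.LFunctions.Zhang2022.Repair.Bed (AssumptionAWith)

/-! ## Sufficiency: `‖L(1,χ)‖ ≤ 𝓛⁻¹⁵` already gives Lemma 5.8 -/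

/-- **Lemma 5.8 from the minimum premise `‖L(1,χ)‖ ≤ 𝓛⁻¹⁵`** (range `‖s−1‖ ≤ Kπ𝓛⁻⁹`, `Kπ ≤ 𝓛⁸`, `log D ≥ 3`,
`χ` primitive): `‖L(s,χ) − L′(1,χ)(s−1)‖ ≤ (1 + 16e^{9/2}π²K²)·𝓛⁻¹⁵` — the tree's proof of `Lemma58.lemma_5_8_of_le`
verbatim with its line `‖L(1,χ)‖ ≤ 𝓛⁻²⁰²² ≤ 𝓛⁻¹⁵` replaced by the hypothesis. The (A)-exponent this passage consumes is
15, not 2022. [cite: Zhang2022LandauSiegel, §5, Lemma 5.8] -/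
theorem lemma58_of_norm_le_pow15 {D : ℕ} [NeZero D] (χ : DirichletCharacter ℂ D) (hprim : χ.IsPrimitive)
    (hL : 3 ≤ Real.log D) (h15 : ‖χ.LFunction 1‖ ≤ 1 / Real.log D ^ 15) {K : ℝ}
    (hKL : K * π ≤ Real.log D ^ 8) {s : ℂ} (hs : ‖s - 1‖ ≤ K * π / Real.log D ^ 9) :
    ‖χ.LFunction s - deriv χ.LFunction 1 * (s - 1)‖ ≤
      (1 + 16 * Real.exp (9 / 2) * π ^ 2 * K ^ 2) / Real.log D ^ 15 := by
  set Lg : ℝ := Real.log D with hLdef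
  have hL0 : 0 < Lg := by linarith
  have hπ := Real.pi_pos
  -- the disc `|s−1| ≤ Kα` is inside `|s−1| ≤ 1/𝓛`
  have hs1 : ‖s - 1‖ ≤ 1 / Real.log D := by
    rw [← hLdef]
    refine hs.trans ?_
    rw [div_le_div_iff₀ (by positivity) hL0]
    calc K * π * Lg ≤ Lg ^ 8 * Lg := mul_le_mul_of_nonneg_right hKL hL0.le
      _ = 1 * Lg ^ 9 := by ring
  have hrem := norm_taylor_two_remainder_le χ hL hprim hs1
  rw [← hLdef] at hrem
  -- `‖L(s) − L′(1)(s−1)‖ ≤ ‖L(1)‖ + remainder`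
  have hsplit : ‖χ.LFunction s - deriv χ.LFunction 1 * (s - 1)‖ ≤
      ‖χ.LFunction 1‖ + ‖χ.LFunction s - χ.LFunction 1 - deriv χ.LFunction 1 * (s - 1)‖ := by
    have := norm_add_le (χ.LFunction 1) (χ.LFunction s - χ.LFunction 1 - deriv χ.LFunction 1 * (s - 1))
    rw [show χ.LFunction 1 + (χ.LFunction s - χ.LFunction 1 - deriv χ.LFunction 1 * (s - 1)) =
      χ.LFunction s - deriv χ.LFunction 1 * (s - 1) by ring] at this
    exact this
  have hE := Real.exp_pos (9 / 2)
  have hrem' : ‖χ.LFunction s - χ.LFunction 1 - deriv χ.LFunction 1 * (s - 1)‖ ≤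
      16 * Real.exp (9 / 2) * π ^ 2 * K ^ 2 / Lg ^ 15 := by
    refine hrem.trans ?_
    have h1L : 1 + Lg ≤ 2 * Lg := by linarith
    calc 8 * Real.exp (9 / 2) * (1 + Lg) * Lg ^ 2 * ‖s - 1‖ ^ 2
        ≤ 8 * Real.exp (9 / 2) * (2 * Lg) * Lg ^ 2 * (K * π / Lg ^ 9) ^ 2 := by gcongr
      _ = 16 * Real.exp (9 / 2) * π ^ 2 * K ^ 2 / Lg ^ 15 := by field_simp; ring
  calc ‖χ.LFunction s - deriv χ.LFunction 1 * (s - 1)‖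
      ≤ ‖χ.LFunction 1‖ + ‖χ.LFunction s - χ.LFunction 1 - deriv χ.LFunction 1 * (s - 1)‖ := hsplit
    _ ≤ 1 / Lg ^ 15 + 16 * Real.exp (9 / 2) * π ^ 2 * K ^ 2 / Lg ^ 15 := add_le_add h15 hrem'
    _ = (1 + 16 * Real.exp (9 / 2) * π ^ 2 * K ^ 2) / Lg ^ 15 := by rw [hLdef]; ring

/-- **Lemma 5.8 on its printed range `‖s−1‖ ≤ 10α` from the minimum premise `‖L(1,χ)‖ ≤ 𝓛⁻¹⁵`**:
`‖L(s,χ) − L′(1,χ)(s−1)‖ ≤ (1 + 1600e^{9/2}π²)·𝓛⁻¹⁵` (`log D ≥ 3`, `χ` primitive).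
[cite: Zhang2022LandauSiegel, §5, Lemma 5.8] -/
theorem lemma58_printed_of_norm_le_pow15 {D : ℕ} [NeZero D] (χ : DirichletCharacter ℂ D)
    (hprim : χ.IsPrimitive) (hL : 3 ≤ Real.log D) (h15 : ‖χ.LFunction 1‖ ≤ 1 / Real.log D ^ 15)
    {s : ℂ} (hs : ‖s - 1‖ ≤ 10 * π / Real.log D ^ 9) :
    ‖χ.LFunction s - deriv χ.LFunction 1 * (s - 1)‖ ≤
      (1 + 1600 * Real.exp (9 / 2) * π ^ 2) / Real.log D ^ 15 := by
  have hπ4 : π ≤ 4 := by linarith [Real.pi_lt_four]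
  have hKL : 10 * π ≤ Real.log D ^ 8 := by
    calc 10 * π ≤ 10 * 4 := by gcongr
      _ ≤ 3 ^ 8 := by norm_num
      _ ≤ Real.log D ^ 8 := pow_le_pow_left₀ (by norm_num) hL 8
  have h := lemma58_of_norm_le_pow15 χ hprim hL h15 (K := 10) hKL hs
  refine h.trans (le_of_eq ?_)
  ring

/-- **Lemma 5.8 from Assumption (A) with ANY exponent `E ≥ 15`** (`Repair.Bed.AssumptionAWith E D χ :
‖L(1,χ)‖ < (log D)^{−E}`; the printed (A) is `E = 2022`, `Repair.Bed.assumptionA_iff_with`): for `log D ≥ 3`,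
`(log D)^{−E} ≤ (log D)^{−15}`. The kernel form of GAP G-31's «main terms only: E ≥ 15».
[cite: Zhang2022LandauSiegel, §5, Lemma 5.8] -/
theorem lemma58_of_assumptionAWith {D : ℕ} [NeZero D] (χ : DirichletCharacter ℂ D) (hprim : χ.IsPrimitive)
    (hL : 3 ≤ Real.log D) {E : ℝ} (hE : 15 ≤ E) (hA : AssumptionAWith E D χ) {K : ℝ}
    (hKL : K * π ≤ Real.log D ^ 8) {s : ℂ} (hs : ‖s - 1‖ ≤ K * π / Real.log D ^ 9) :
    ‖χ.LFunction s - deriv χ.LFunction 1 * (s - 1)‖ ≤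
      (1 + 16 * Real.exp (9 / 2) * π ^ 2 * K ^ 2) / Real.log D ^ 15 := by
  refine lemma58_of_norm_le_pow15 χ hprim hL ?_ hKL hs
  unfold AssumptionAWith at hA
  have hL1 : 1 ≤ Real.log D := by linarith
  have hpow : Real.log D ^ (15 : ℝ) ≤ Real.log D ^ E := Real.rpow_le_rpow_of_exponent_le hL1 hE
  have h15 : (0 : ℝ) < Real.log D ^ (15 : ℝ) := Real.rpow_pos_of_pos (by linarith) _
  have hle : 1 / Real.log D ^ E ≤ 1 / Real.log D ^ (15 : ℝ) := one_div_le_one_div_of_le h15 hpow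
  have hcast : Real.log D ^ (15 : ℝ) = Real.log D ^ (15 : ℕ) := by
    rw [show (15 : ℝ) = ((15 : ℕ) : ℝ) by norm_num, Real.rpow_natCast]
  rw [hcast] at hle
  exact (hA.le.trans hle)

/-! ## Necessity: Lemma 5.8's conclusion forces `‖L(1,χ)‖ = O(𝓛⁻¹⁵)` -/

/-- **The exponent 15 is the minimum this passage can consume**: if the conclusion of Lemma 5.8 holds with some
constant `C` on any range `‖s−1‖ ≤ r` with `r ≥ 0` (so containing `s = 1`), then `‖L(1,χ)‖ ≤ C·𝓛⁻¹⁵` — evaluate at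
`s = 1`. With `lemma58_of_norm_le_pow15`: the Lemma 5.8 step of the (A)-chain closes under `‖L(1,χ)‖ ≤ 𝓛⁻¹⁵` and under
no premise of weaker order. [cite: Zhang2022LandauSiegel, §5, Lemma 5.8] -/
theorem norm_LFunction_one_le_of_lemma58 {D : ℕ} [NeZero D] (χ : DirichletCharacter ℂ D) {r C : ℝ}
    (hr : 0 ≤ r)
    (h : ∀ s : ℂ, ‖s - 1‖ ≤ r → ‖χ.LFunction s - deriv χ.LFunction 1 * (s - 1)‖ ≤ C / Real.log D ^ 15) :
    ‖χ.LFunction 1‖ ≤ C / Real.log D ^ 15 := by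
  have h1 := h 1 (by simpa using hr)
  simpa using h1

end Literature.NumberTheory.LFunctions.Zhang2022.Repair.Gap
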